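import Summits.CriticalPhenomena.PercolationContinuityZ3.Theorems.PercNearOneGluingNoHeavyLowerTailAntitheticThetaHandle
import Summits.CriticalPhenomena.PercolationContinuityZ3.Theorems.PercNearOneGluingNoHeavyLowerTailAntitheticHandleForest
import HarnessLib

/-!
# `NoHeavyLowerTail` (stmt-CriticalPhenomena-4575) — antithetic cluster pairs: BOX PARTITIONS SURVIVE PENDANT FORESTS, and
# THEOREM Θ² WITH PENDANT TREES (HOME/MEMO-gen63.md §4/§6 (P1); prim-hp-2 gen 63)

Support file (`--supports stmt-CriticalPhenomena-4575`, hull-port prover `prim-hp-2`, gen 63).  No definitions, no named facts, no sorries;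
standard axioms.  Notation of …AntitheticBoxes / …HandleForest: a PENDANT FOREST on an edge set `E` is a leaf sequence `s(att i, ℓ i)`,
`i < m`, each leaf `ℓ k` fresh for `E` and the earlier leaves, `att k ≠ ℓ k`, `s ≠ ℓ k`.
* `Antithetic.Box.boxes_leaves` — the ∃-TRANSFORMER: a red-dominated box partition of `{P ∈ X_E}` with fixed pairs inside `E` (cover /
  inside / uniqueness / domination) is one of `{P ∈ X_{E ∪ forest}}` for every pendant forest avoiding `P` — same boxes, the leaf pairs free
  (`Box.mem_leaves_iff`, `Box.dom_leaves`).  So every consumer of box partitions (⊕-positivity, ⊕ ⇒ M, the ⊕-HANDLE THEOREM) extends to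
  graphs with pendant trees for free.
* `Antithetic.Cyc.theta_forest_handle_vertex_sum_nonneg` — **THEOREM Θ² WITH PENDANT TREES**: θ-graph (cycle through `s` + ear), any
  pendant forest, plus a handle through `x` from a θ-vertex `P` (`{s,P}` not the poles) to any vertex `Q`: the vertex antithetic inequality
  at `R = {x}` (CONJECTURE Δ2).
[cite: VandenbergHaggstromKahn2005, §1 p. 6 ("Harris' inequality"), §1 p. 3 (open cluster `C_s`)]
-/

noncomputable section

namespace Summit.CriticalPhenomena.PercolationContinuityZ3.Theorems

open Literature.Probability.Percolation
open scoped Classical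

namespace Antithetic

namespace Box

variable {V : Type*} {E : Set (Sym2 V)} {s : V} {att ℓ : ℕ → V} {m : ℕ}

/-- **Box partitions survive pendant forests.**  Boxes `(Fix c, N c)` with `Fix c ⊆ E` partitioning `{P ∈ X_E}` into red-dominated boxes
also partition `{P ∈ X_{E ∪ forest}}` into red-dominated boxes, for every leaf sequence avoiding `P`. [this work] -/
theorem boxes_leaves (hleaf : ∀ k, k < m → ∀ f ∈ E ∪ {e | ∃ i, i < k ∧ e = s(att i, ℓ i)}, ℓ k ∈ f → f.IsDiag)
    (hne : ∀ k, k < m → att k ≠ ℓ k) (hsℓ : ∀ k, k < m → s ≠ ℓ k) {P : V} (hPℓ : ∀ i, i < m → P ≠ ℓ i)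
    {C : Type*} (Fix N : C → Set (Sym2 V)) (hFixE : ∀ c, Fix c ⊆ E)
    (hcover : ∀ T : Set (Sym2 V), P ∈ openCluster (T ∩ E) s → ∃ c, ∀ e ∈ Fix c, (e ∈ T ↔ e ∈ N c))
    (hinside : ∀ c (T : Set (Sym2 V)), (∀ e ∈ Fix c, (e ∈ T ↔ e ∈ N c)) → P ∈ openCluster (T ∩ E) s)
    (hdom : ∀ c (T T' : Set (Sym2 V)), (∀ e ∈ Fix c, (e ∈ T ↔ e ∈ N c)) → (∀ e ∈ Fix c, (e ∈ T' ↔ e ∈ N c)) →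
      (∀ e ∉ Fix c, (e ∈ T' ↔ e ∉ T)) → openCluster (T'ᶜ ∩ E) s ⊆ openCluster (T ∩ E) s) :
    (∀ c, Fix c ⊆ E ∪ {e | ∃ i, i < m ∧ e = s(att i, ℓ i)}) ∧
    (∀ T : Set (Sym2 V), P ∈ openCluster (T ∩ (E ∪ {e | ∃ i, i < m ∧ e = s(att i, ℓ i)})) s →
      ∃ c, ∀ e ∈ Fix c, (e ∈ T ↔ e ∈ N c)) ∧
    (∀ c (T : Set (Sym2 V)), (∀ e ∈ Fix c, (e ∈ T ↔ e ∈ N c)) →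
      P ∈ openCluster (T ∩ (E ∪ {e | ∃ i, i < m ∧ e = s(att i, ℓ i)})) s) ∧
    (∀ c (T T' : Set (Sym2 V)), (∀ e ∈ Fix c, (e ∈ T ↔ e ∈ N c)) → (∀ e ∈ Fix c, (e ∈ T' ↔ e ∈ N c)) →
      (∀ e ∉ Fix c, (e ∈ T' ↔ e ∉ T)) →
      openCluster (T'ᶜ ∩ (E ∪ {e | ∃ i, i < m ∧ e = s(att i, ℓ i)})) s ⊆
        openCluster (T ∩ (E ∪ {e | ∃ i, i < m ∧ e = s(att i, ℓ i)})) s) := by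
  refine ⟨fun c => (hFixE c).trans Set.subset_union_left, fun T hT => hcover T ((mem_leaves_iff hleaf hne hsℓ le_rfl T hPℓ).1 hT),
    fun c T hT => (mem_leaves_iff hleaf hne hsℓ le_rfl T hPℓ).2 (hinside c T hT), fun c T T' hT hT' hflip => ?_⟩
  exact dom_leaves hleaf hne hsℓ le_rfl (fun i hi => hflip _ fun h => leaf_pair_not_mem hleaf hne hi (hFixE c h))
    (hdom c T T' hT hT' hflip)

end Box

namespace Cyc

variable {V : Type*} [Fintype V] {n : ℕ} {v : ℕ → V} {ℓ : ℕ} {r : ℕ → V} {α β p : ℕ} {att lf : ℕ → V} {m : ℕ}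
  (hn : 3 ≤ n) (hinj : ∀ i j, i < n → j < n → v i = v j → i = j) (hper : v n = v 0) (hℓ : 1 ≤ ℓ)
  (hαβ : α < β) (hβn : β < n) (hp0 : 0 < p) (hpn : p < n) (hexc : ¬ (α = 0 ∧ p = β)) (hr0 : r 0 = v α) (hrℓ : r ℓ = v β)
  (hrfresh : ∀ j, 0 < j → j < ℓ → ∀ i, i ≤ n → r j ≠ v i) (hrinj : ∀ i j, i ≤ ℓ → j ≤ ℓ → r i = r j → i = j)
  (hRC : ∀ m, m < ℓ → ∀ i, i < n → edge r m ≠ edge v i)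
  (hleaf : ∀ k, k < m → ∀ f ∈ (edgeSet n v ∪ edgeSet ℓ r) ∪ {e | ∃ i, i < k ∧ e = s(att i, lf i)}, lf k ∈ f → f.IsDiag)
  (hne : ∀ k, k < m → att k ≠ lf k) (hsl : ∀ k, k < m → v 0 ≠ lf k)
  {ya za : ℕ → V} {a b : ℕ} {Q : V} (hy0 : ya 0 = v p) (hz0 : za 0 = Q)
  (hzfresh : ∀ i, 0 < i → i ≤ b → ∀ f ∈ (edgeSet n v ∪ edgeSet ℓ r) ∪ {e | ∃ i, i < m ∧ e = s(att i, lf i)}, za i ∈ f → f.IsDiag)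
  (hzinj : ∀ i j, i ≤ b → j ≤ b → za i = za j → i = j)
  (hsz : ∀ i, 0 < i → i ≤ b → v 0 ≠ za i) (hPz : ∀ i, 0 < i → i ≤ b → v p ≠ za i)
  (hyfresh : ∀ i, 0 < i → i ≤ a →
    ∀ f ∈ ((edgeSet n v ∪ edgeSet ℓ r) ∪ {e | ∃ i, i < m ∧ e = s(att i, lf i)}) ∪ edgeSet b za, ya i ∈ f → f.IsDiag)
  (hyinj : ∀ i j, i ≤ a → j ≤ a → ya i = ya j → i = j)
  (hsy : ∀ i, 0 < i → i ≤ a → v 0 ≠ ya i) (hzy : ∀ i, 0 < i → i ≤ a → za b ≠ ya i)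
include hn hinj hper hℓ hαβ hβn hp0 hpn hexc hr0 hrℓ hrfresh hrinj hRC hleaf hne hsl hy0 hz0 hzfresh hzinj hsz hPz hyfresh hyinj hsy hzy

/-- **THEOREM Θ² with pendant trees.**  `K` = θ-graph `Cyc.edgeSet n v ∪ Cyc.edgeSet ℓ r` (cycle through `s = v 0`, ear `v α … v β`) with a
pendant forest `s(att i, lf i)` (`i < m`); `P = v p` a cycle vertex, `s`, `P` not both poles; `Q` any vertex; arms `ya 0 = P, …, ya a = y`,
`za 0 = Q, …, za b = z` fresh, `x` fresh, `yz ∉ H = K ∪ forest ∪ arms`, `E = H + xz + xy`.  Then for all monotone `F, G`: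
`0 ≤ Σ_{ω : ¬(x ∈ X_E ω ∧ x ∈ Y_E ω)} (F(X_E ω) − F(Y_E ω))·(G(X_E ω) − G(Y_E ω))`. [this work] -/
theorem theta_forest_handle_vertex_sum_nonneg {x : V}
    (hx : ∀ f ∈ (edgeSet b za ∪ ((edgeSet n v ∪ edgeSet ℓ r) ∪ {e | ∃ i, i < m ∧ e = s(att i, lf i)})) ∪ edgeSet a ya,
      x ∈ f → f.IsDiag)
    (hxs : x ≠ v 0) (hxy : x ≠ ya a) (hxz : x ≠ za b) (hyz : ya a ≠ za b)
    (hg : s(ya a, za b) ∉ (edgeSet b za ∪ ((edgeSet n v ∪ edgeSet ℓ r) ∪ {e | ∃ i, i < m ∧ e = s(att i, lf i)})) ∪ edgeSet a ya)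
    {F G : Set V → ℝ} (hF : Monotone F) (hG : Monotone G) :
    0 ≤ ∑ ω ∈ Finset.univ.filter (fun ω : Set (Sym2 V) =>
        ¬ ((openGraph (ω ∩ insert s(x, ya a) (insert s(x, za b)
              ((edgeSet b za ∪ ((edgeSet n v ∪ edgeSet ℓ r) ∪ {e | ∃ i, i < m ∧ e = s(att i, lf i)})) ∪
                edgeSet a ya)))).Reachable (v 0) x ∧
          (openGraph (ωᶜ ∩ insert s(x, ya a) (insert s(x, za b)
              ((edgeSet b za ∪ ((edgeSet n v ∪ edgeSet ℓ r) ∪ {e | ∃ i, i < m ∧ e = s(att i, lf i)})) ∪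
                edgeSet a ya)))).Reachable (v 0) x)),
      (F (openCluster (ω ∩ insert s(x, ya a) (insert s(x, za b)
            ((edgeSet b za ∪ ((edgeSet n v ∪ edgeSet ℓ r) ∪ {e | ∃ i, i < m ∧ e = s(att i, lf i)})) ∪ edgeSet a ya))) (v 0)) -
          F (openCluster (ωᶜ ∩ insert s(x, ya a) (insert s(x, za b)
            ((edgeSet b za ∪ ((edgeSet n v ∪ edgeSet ℓ r) ∪ {e | ∃ i, i < m ∧ e = s(att i, lf i)})) ∪ edgeSet a ya))) (v 0))) *
        (G (openCluster (ω ∩ insert s(x, ya a) (insert s(x, za b)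
            ((edgeSet b za ∪ ((edgeSet n v ∪ edgeSet ℓ r) ∪ {e | ∃ i, i < m ∧ e = s(att i, lf i)})) ∪ edgeSet a ya))) (v 0)) -
          G (openCluster (ωᶜ ∩ insert s(x, ya a) (insert s(x, za b)
            ((edgeSet b za ∪ ((edgeSet n v ∪ edgeSet ℓ r) ∪ {e | ∃ i, i < m ∧ e = s(att i, lf i)})) ∪ edgeSet a ya))) (v 0))) := by
  obtain ⟨C, Fix, N, hFixE, hcover, hinside, huniq, hdom⟩ :=
    ear_boxes hn hinj hper hℓ hαβ hβn hp0 hpn hexc hr0 hrℓ hrfresh hrinj hRC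
  -- `P = v p` lies on the cycle pair `edge v p`, so it is not a leaf
  have hPℓ : ∀ i, i < m → v p ≠ lf i := by
    intro i hi h
    have hd := hleaf i hi (edge v p) (Or.inl (Or.inl ⟨p, hpn, rfl⟩)) (by rw [← h, edge]; exact Sym2.mem_mk_left _ _)
    rw [edge, Sym2.mk_isDiag_iff] at hd
    exact v_ne_succ hn hinj hper hpn hd
  obtain ⟨hFixE', hcover', hinside', hdom'⟩ := Box.boxes_leaves hleaf hne hsl hPℓ Fix N hFixE hcover hinside hdom
  -- the θ-graph with its forest is loop-free
  have hnd : ∀ f ∈ (edgeSet n v ∪ edgeSet ℓ r) ∪ {e | ∃ i, i < m ∧ e = s(att i, lf i)}, ¬ f.IsDiag := by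
    rintro f ((⟨i, hi, rfl⟩ | ⟨j, hj, rfl⟩) | ⟨i, hi, rfl⟩)
    · rw [edge, Sym2.mk_isDiag_iff]; exact v_ne_succ hn hinj hper hi
    · rw [edge, Sym2.mk_isDiag_iff]
      intro h
      exact absurd (hrinj j (j + 1) hj.le hj h) (by omega)
    · rw [Sym2.mk_isDiag_iff]; exact hne i hi
  exact Pendant.handle_vertex_sum_nonneg_of_boxes hzfresh hzinj hsz hPz Fix N hFixE' hcover' hinside' huniq hdom' hy0 hz0 hyfresh
    hyinj hsy hzy hnd hx hxs hxy hxz hyz hg hF hG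

end Cyc

end Antithetic

end Summit.CriticalPhenomena.PercolationContinuityZ3.Theorems
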